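import Summits.QuantumFields.YangMills.Theorems.BalabanUVNodesPortS1HalvesDefs

/-!
# K0⁷ — THE RECORD-SIDE FORMAT NAMES, EDITION 22 = FLUCTUATION CARRIERS, STAGE 1 (▶ porter PT-A-1 g7's `FE-SPLIT-PROPOSAL-v1.md` §1, ★★★ director-ym №545 (3)):
# `recordCt` (print's non-linear part `C̃ = Q̃ − LQ̃` of the constraint, p.267) and `recordVpot` (print's `V` of (2.8): the terms of order ≥ 3 of `A ∘ U_k ∘ pert`), with their
# record-pinned twins `recordCtAx ∕ recordVpotAx` along `θ := thetaFill`, `V^{(k)} := portVkAx`, `εbg := a₀`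

Cell `ym-nodeO-ideate` ∕ `ym-balaban-port`, DEFINER seat `ym-nodeO-def-1` (gen 36); `--kind definition --supports stmt-QuantumFields-20541 --as helper`; count-neutral.
[I] = [Balaban1987RG1], [15] = [Balaban1985Variational].

WHY.  The (R3′) FE carrier `recordFluctInt` (= print's (2.13) `𝐄^{(k+1)}(g_k, U_{k+1}(W_B))` at the record = `D_rec.newTerm (g k)` for the record `FluctData`) is the prerequisite PT-A-1 names for
splitting 27930's `stub_FE` (proposal §1∕§2).  DEF-1 g36's sizing (nodeO STATUS 2026-08-31T09:4xZ): the CLOSED carrier needs four record objects not yet in the tree — (o1) the linearising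
translation `D̃` of p.267, (o2) the Haar exp-chart Jacobian `σ(B′)`, (o3) the `Tr log(1 − h δD̃∕δB)` Jacobian, (o4) the previous effective action `E_k` read in the chart — so it lands in two stages.
THIS FILE is STAGE 1: the two S-sized sub-carriers the proposal spells out by formula, over ed.15∕15c's names, plus their record-pinned twins in ▶ PT-A-1's own letters (`portVkAx`, `thetaFill`,
`εbg = a₀`).  Nothing here needs (o1)–(o4).

WHAT THIS FILE IS (definitions only; statement-form; NEW names; every earlier object untouched — append-only rule):
* §24k `recordCt F k K Vk x := recordQt F k K Vk x − recordLQt F k K Vk x` — print's `C̃(B′)` («the function Q(B′) … LQ B′ + C(B′)», p.267; S2A-SPEC-v1's `Ct_rec`; its second-order part is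
  ed.15's `recordC2`).
* §24k `recordVpot F k K εbg Vk x := recordAUk … x − recordAUk … 0 − recordDAUk … x − ½·recordD2AUk … x x` — print's `V(H₁B′)` of (2.8), «terms of at least third order», BY SUBTRACTION over
  ed.15c's (2.10)–(2.11) objects (PT-A-1's formula verbatim).
* §24k `recordCtAx ∕ recordVpotAx F a₀ ε₂₉ k K B x` — the same at `θ := thetaFill F a₀ ε₂₉`, `V^{(k)} := portVkAx F a₀ ε₂₉ k K B` (the axial critical configuration of the charted datum,
  ▶ PT-A-1's ✓ `…PortS1HalvesDefs` :84), `εbg := a₀` — the letters `phiLZ ∕ portLogZLocAt` already use.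

NOT HERE (stage 2, BLOCKED-ON (o1)–(o4)): the record Gaussian `dμ_{C^{(k)}}` as a total object on `VecField`, the exponents `𝐏^{(k)}_rec ∕ {…}_rec`, `recordFluctData ∕ recordFluctInt`.

HONEST FRAMING.  Definitions only; NOTHING of Bałaban is asserted, ported or discharged; `recordVpot` is «of order ≥ 3» only as a NAME (the Taylor fact needs differentiability of
`recordAUk` — HypAn∕P0-class — and is not claimed); `recordQt ∕ recordLQt ∕ recordAUk ∕ recordDAUk ∕ recordD2AUk` are `mlog`∕`fderiv`-built and junk off the small-field∕differentiable regime, SAID in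
their own files; `stub_FE` (XXL), `stub_LZdet` (P0-ℂ), ⟨26900⟩ OPEN; 27930 OPEN (stubs 2∕4 closed by name per PT-A-1); K0ᴬ ∕ K1ᴬ ∕ K3ᴬ OPEN; NODE O not inhabited (0∕1); COUNT 8∕28 · K 1∕4
UNMOVED; finite `𝕋⁴_{L^K}` at fixed ε — NOT continuum ∕ ℝ⁴ ∕ OS; **the Yang–Mills mass gap (Clay) is NOT proved by any of this.**  No `sorry`, `instance`, `notation`; standard axioms.
-/

noncomputable section

open scoped BigOperators Matrix.Norms.L2Operator

namespace Summit.QuantumFields.YangMills.Theorems.K0RecordFormatNames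

open Literature.MathematicalPhysics.QuantumFieldTheory.Balaban1983to89
open Literature.MathematicalPhysics.QuantumFieldTheory.Balaban1983to89.Node00
open Literature.MathematicalPhysics.QuantumFieldTheory.Balaban1983to89.T4Continuum (T4Family)
open Summit.QuantumFields.YangMills.Theorems.BalabanUVNodesPortS1 (portVkAx)

variable (F : T4Family)

/-! ## §24k  Stage-1 fluctuation carriers: `C̃` and `V` -/

/-- **`C̃` — `recordCt F k K Vk x := recordQt F k K Vk x − recordLQt F k K Vk x`**: the NON-LINEAR PART of print's constraint function `Q̃(V^{(k)}, B′)` in the fluctuation coordinates `x`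
(p.267: «LQ B′ + C(B′)»; its quadratic part is ed.15's `recordC2`, «D⁽²⁾(B) = C⁽²⁾(B)»).  S2A-SPEC-v1's `Ct_rec`.  A NAME; nothing asserted. [cite: Balaban1987RG1, p.267, (1.5) p.261] -/
def recordCt (k K : ℕ) (Vk : GaugeField (F.P K) k (SU 2)) (x : FluctIdx F k K → ℝ) : PBond (F.P K) (k + 1) → MatA 2 :=
  recordQt F k K Vk x - recordLQt F k K Vk x

/-- **`V` — `recordVpot F k K εbg Vk x`**: print's `V(H₁B′)` of (2.8), «terms of at least third order in H₁B′» of the action `A(U_k(V′V^{(k)}))`, BY SUBTRACTION of the value, the first and half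
the second derivative at `0` from `A ∘ U_k ∘ pert` (ed.15c's `recordAUk ∕ recordDAUk ∕ recordD2AUk`; ▶ PT-A-1's formula verbatim).  A NAME: that it is `O(|x|³)` is the Taylor fact under
differentiability (HypAn∕P0-class), not claimed here. [cite: Balaban1987RG1, (2.8) p.266, (2.6)–(2.7) p.266] -/
def recordVpot (k K : ℕ) (εbg : ℝ) (Vk : GaugeField (F.P K) k (SU 2)) (x : FluctIdx F k K → ℝ) : ℝ :=
  recordAUk F k K εbg Vk x - recordAUk F k K εbg Vk 0 - recordDAUk F k K εbg Vk x - (1 / 2 : ℝ) * recordD2AUk F k K εbg Vk x x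

/-! ## §24k′  The record-pinned twins along `portVkAx` (`θ := thetaFill F a₀ ε₂₉`, `εbg = a₀`) -/

/-- **`C̃` AT THE RECORD's AXIAL BACKGROUND of the charted datum `B`**: `recordCtAx F a₀ ε₂₉ k K B := recordCt F k K (portVkAx F a₀ ε₂₉ k K B)` (▶ PT-A-1's `V^{(k)}_{ax}(W_B)` =
`critCfgAxOfRecord … (unitField … B)`). [cite: Balaban1987RG1, p.267, (2.3) p.265] -/
def recordCtAx (a₀ ε₂₉ : ℝ) (k K : ℕ) (B : recordW F a₀ ε₂₉ k K) (x : FluctIdx F k K → ℝ) : PBond (F.P K) (k + 1) → MatA 2 :=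
  recordCt F k K (portVkAx F a₀ ε₂₉ k K B) x

/-- **`V` AT THE RECORD's AXIAL BACKGROUND of the charted datum `B`**, background radius `εbg := a₀` (= `(thetaFill F a₀ ε₂₉).εbg`, `theta13OfThm1CCMWZB_εbg`):
`recordVpotAx F a₀ ε₂₉ k K B := recordVpot F k K a₀ (portVkAx F a₀ ε₂₉ k K B)`. [cite: Balaban1987RG1, (2.8) p.266, (2.3) p.265] -/
def recordVpotAx (a₀ ε₂₉ : ℝ) (k K : ℕ) (B : recordW F a₀ ε₂₉ k K) (x : FluctIdx F k K → ℝ) : ℝ :=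
  recordVpot F k K a₀ (portVkAx F a₀ ε₂₉ k K B) x

/-- FACE (by `rfl`): `C̃` splits the constraint — `recordQt = recordLQt + recordCt` pointwise. [cite: Balaban1987RG1, p.267 (bookkeeping)] -/
theorem recordLQt_add_recordCt (k K : ℕ) (Vk : GaugeField (F.P K) k (SU 2)) (x : FluctIdx F k K → ℝ) :
    recordLQt F k K Vk x + recordCt F k K Vk x = recordQt F k K Vk x := by
  rw [recordCt, add_sub_cancel]

end Summit.QuantumFields.YangMills.Theorems.K0RecordFormatNames

end
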